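import Literature.AnabelianGeometry.EtaleTheta.Discharge.Sec2Cor219iAtModelTateOfExtends
import Literature.AnabelianGeometry.EtaleTheta.Discharge.Sec2Cor218iAtModelTateOfExtends
import HarnessLib

/-!
# [EtTh] Cor. 2.19 (i), SUBQUOTIENTS half (`RigidData.Cor219_i_subquotients`, FROZEN FACT-LIST row F-0627), at the
# Tate model `modelχq p i 2` and at the datum of record — FROM `hextΔ` alone (`χ₄ ≡ 1` / `p ≡ 1 (mod 4)` / `i` even)
# and from {`hextΔ`, `hgal`} (every `p`); proof-only one-term knits

S. Mochizuki, *The étale theta function and its Frobenioid-theoretic manifestations*, Publ. RIMS **45** (2009)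
[EtTh], §2, Cor. 2.19 (i) p. 64 («the subquotients `Π•|_(l·Δ•Θ) ⊆ Π•|_(Δ•_Y)^Θ ⊆ Π•|_(Π•_Y)^Θ` … may be
reconstructed group-theoretically»), Cor. 2.18 (i) p. 60 (locators `p.N` = PDF pages of the PRIMS text)
[cite: MochizukiEtTh2009, Cor 2.19 (i) p.64].  Cell `abc-iut`, block F, seat abc-iut-f-148 (gen 7; F-TRANCHES
tranche 148 = F-0627 / F-0628 / F-0629 / F-0630 over `ThetaRigidity.lean`; L2 row «EtTh:Cor2.18(i)(ii) / Cor2.19(ii)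
K4-binder census at the Tate datum», abc-iut-L2-lead gen 7).  PROOF-ONLY: no definition, no instance, no notation,
no new named fact; every input consumed BY NAME — abc-iut-f-149's `cor219_i_subquotients_modelχq`
(`Sec2RigidityAtModelTate`: F-0627 at the stage-2 record ⟸ Cor. 2.18 (i) ALONE, temp-slimness supplied),
abc-iut-L6-d6's `rigidData_cor218_i_modelχq_of_extends_of_levelChar_four` / `_of_mod_four_eq_one` / `_of_even`
(`Sec2Cor218iAtModelTateNonInnerModFour`, p477049) and `rigidData_cor218_i_modelχq_of_extends_of_hgal`
(`Sec2Cor218iAtModelTateOfExtends`, p468072), abc-iut-w5-d171's `prop15iii_etaleThetaDataχqInr`; nothing restated.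

STATE OF RECORD BEFORE THIS FILE.  The SPLITTINGS half of Cor. 2.19 (i) (F-0626) is in the tree at the Tate model from
`hextΔ` alone (abc-iut-w6-d050 `cor219_i_splittings_modelχq_of_extends_of_mod_four_eq_one` & co., p478893) and from
{`hextΔ`, `hgal`} (abc-iut-L1-t6 `Sec2Cor219iAtModelTateOfExtendsHgal`, p479283).  The SUBQUOTIENTS half (F-0627) was
in the tree only modulo the Cor. 2.18 (i) binder `h218i` (`cor219_i_subquotients_modelχq`) — the one-term
composition with abc-iut-L6-d6's reductions was missing.  This file supplies it.

WHAT THIS FILE DOES (`L := L∅`, the empty cusp labelling):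
* §1 generic datum `E` over `modelχq p i 2`, every `X̲̲`-choice `C`, every level `μ`:
  `cor219_i_subquotients_modelχq_of_extends_of_levelChar_four` (`χ₄ ≡ 1`), `_of_mod_four_eq_one` (`p ≡ 1 (mod 4)`),
  `_of_even` (`i` even) — F-0627 ⟸ `hextΔ` ALONE; `cor219_i_subquotients_modelχq_of_extends_of_hgal` — F-0627 ⟸
  {`hextΔ`, `hgal`} (every `p`, every `i`);
* §2 the datum of record (`i = 1`, `E := etaleThetaDataχqInr p`, `h15 :=` abc-iut-w5-d171's theorem):
  `cor219_i_subquotients_modelTate_inr_of_extends_of_mod_four_eq_one`, `_of_extends_of_hgal`, and the joint form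
  `cor219_i_modelTate_inr_of_extends_of_mod_four_eq_one` (subquotients ∧ splittings ⟸ `hextΔ`, `p ≡ 1 (mod 4)`).

RESIDUAL for F-0627 at the Tate datum after this file: `hextΔ` (for `p ≡ 1 (mod 4)` / `χ₄ ≡ 1` / `i` even), resp.
{`hextΔ`, `hgal`} (every `p`); EMPTY labelling only (a genuine cusp labelling needs a cusp-transport datum); at
`p ≢ 1 (mod 4)`, `i` odd, without (HGAL): abc-iut-L6-d6's parity residual (`map_GtpYdd_eq_iff_levelHom_two_y_eq_zero`).
HONEST LABEL: `modelχq` is a SEMI-SYNTHETIC model of the typed §1 interface — binder-discharge / consistency evidence for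
OUR typed rows only; nothing of [EtTh] (refereed) is asserted; a FACT row is an assumption label, not an endorsement; no
side is taken on [IUTchIII] Cor. 3.12; typed ≠ proved.
-/

noncomputable section

namespace Literature.AnabelianGeometry.EtaleTheta.SettingModel

open Literature.AnabelianGeometry.SemiGraphs

variable (p : ℕ) [Fact p.Prime] (i : ℤ)

/-! ## §1. `modelχq p i 2`: Cor. 2.19 (i) subquotients from `hextΔ` (empty cusp labelling) -/

/-- **F-0627 Cor. 2.19 (i), subquotients, at `modelχq p i 2` FROM `hextΔ`, GIVEN `χ₄ ≡ 1` on `G_{ℚ_p}`** (abc-iut-f-149's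
`cor219_i_subquotients_modelχq` ∘ abc-iut-L6-d6's `rigidData_cor218_i_modelχq_of_extends_of_levelChar_four`).
[cite: MochizukiEtTh2009, Cor 2.19 (i) p.64] -/
theorem cor219_i_subquotients_modelχq_of_extends_of_levelChar_four
    (h4 : ∀ τ : GQp p, ZHatLevel.levelChar 4 (chi p τ) = 1)
    {E : (ThetaSetting.modelχq p i 2 even_two).EtaleThetaData} {l : ℕ} (C : E.DoubleUnderline l) {N : ℕ+}
    (μ : (ThetaSetting.modelχq p i 2 even_two).CyclotomeMod l N) (hC : (ThetaSetting.modelχq p i 2 even_two).Compat)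
    (hS : (ThetaSetting.modelχq p i 2 even_two).Sec2Hyps) (h15 : ThetaSetting.Prop15iii E hC)
    (hext : ∀ γ : ↥C.Huu ≃ₜ* ↥C.Huu, ∃ Γ : PiTpχq p i 2 ≃ₜ* PiTpχq p i 2,
      (∀ h : C.Huu, Γ (h : PiTpχq p i 2) = ((γ h : C.Huu) : PiTpχq p i 2)) ∧
        (curveχq p i 2).DeltaTemp.map Γ.toMulEquiv.toMonoidHom = (curveχq p i 2).DeltaTemp) :
    Literature.AnabelianGeometry.EtaleTheta.RigidData.Cor219_i_subquotients
      (C.rigidData μ hC hS h15 ⟨fun _ => ∅, fun _ => ∅, fun _ => rfl⟩) :=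
  cor219_i_subquotients_modelχq p i 2 even_two C μ hC hS h15 _
    (rigidData_cor218_i_modelχq_of_extends_of_levelChar_four p i h4 C μ hC hS h15 hext)

/-- **F-0627 Cor. 2.19 (i), subquotients, at `modelχq p i 2` FROM `hextΔ` ALONE, for `p ≡ 1 (mod 4)`** (every `i`; in
particular at the Tate model of record `i = 1`). [cite: MochizukiEtTh2009, Cor 2.19 (i) p.64] -/
theorem cor219_i_subquotients_modelχq_of_extends_of_mod_four_eq_one (hp : p % 4 = 1)
    {E : (ThetaSetting.modelχq p i 2 even_two).EtaleThetaData} {l : ℕ} (C : E.DoubleUnderline l) {N : ℕ+}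
    (μ : (ThetaSetting.modelχq p i 2 even_two).CyclotomeMod l N) (hC : (ThetaSetting.modelχq p i 2 even_two).Compat)
    (hS : (ThetaSetting.modelχq p i 2 even_two).Sec2Hyps) (h15 : ThetaSetting.Prop15iii E hC)
    (hext : ∀ γ : ↥C.Huu ≃ₜ* ↥C.Huu, ∃ Γ : PiTpχq p i 2 ≃ₜ* PiTpχq p i 2,
      (∀ h : C.Huu, Γ (h : PiTpχq p i 2) = ((γ h : C.Huu) : PiTpχq p i 2)) ∧
        (curveχq p i 2).DeltaTemp.map Γ.toMulEquiv.toMonoidHom = (curveχq p i 2).DeltaTemp) :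
    Literature.AnabelianGeometry.EtaleTheta.RigidData.Cor219_i_subquotients
      (C.rigidData μ hC hS h15 ⟨fun _ => ∅, fun _ => ∅, fun _ => rfl⟩) :=
  cor219_i_subquotients_modelχq p i 2 even_two C μ hC hS h15 _
    (rigidData_cor218_i_modelχq_of_extends_of_mod_four_eq_one p i hp C μ hC hS h15 hext)

/-- **F-0627 Cor. 2.19 (i), subquotients, at `modelχq p i 2` FROM `hextΔ` ALONE, for EVEN `i`** (every `p`).
[cite: MochizukiEtTh2009, Cor 2.19 (i) p.64] -/
theorem cor219_i_subquotients_modelχq_of_extends_of_even (hi : Even i)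
    {E : (ThetaSetting.modelχq p i 2 even_two).EtaleThetaData} {l : ℕ} (C : E.DoubleUnderline l) {N : ℕ+}
    (μ : (ThetaSetting.modelχq p i 2 even_two).CyclotomeMod l N) (hC : (ThetaSetting.modelχq p i 2 even_two).Compat)
    (hS : (ThetaSetting.modelχq p i 2 even_two).Sec2Hyps) (h15 : ThetaSetting.Prop15iii E hC)
    (hext : ∀ γ : ↥C.Huu ≃ₜ* ↥C.Huu, ∃ Γ : PiTpχq p i 2 ≃ₜ* PiTpχq p i 2,
      (∀ h : C.Huu, Γ (h : PiTpχq p i 2) = ((γ h : C.Huu) : PiTpχq p i 2)) ∧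
        (curveχq p i 2).DeltaTemp.map Γ.toMulEquiv.toMonoidHom = (curveχq p i 2).DeltaTemp) :
    Literature.AnabelianGeometry.EtaleTheta.RigidData.Cor219_i_subquotients
      (C.rigidData μ hC hS h15 ⟨fun _ => ∅, fun _ => ∅, fun _ => rfl⟩) :=
  cor219_i_subquotients_modelχq p i 2 even_two C μ hC hS h15 _
    (rigidData_cor218_i_modelχq_of_extends_of_even p i hi C μ hC hS h15 hext)

/-- **F-0627 Cor. 2.19 (i), subquotients, at `modelχq p i 2` FROM {`hextΔ`, `hgal`}** (every `p`, every `i`; `hgal`: every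
topological automorphism of `Π^tp_{X̲̲}` lies over an INNER automorphism of `G_{ℚ_p}`) — abc-iut-f-149's
`cor219_i_subquotients_modelχq` ∘ abc-iut-L6-d6's `rigidData_cor218_i_modelχq_of_extends_of_hgal`.
[cite: MochizukiEtTh2009, Cor 2.19 (i) p.64] -/
theorem cor219_i_subquotients_modelχq_of_extends_of_hgal
    {E : (ThetaSetting.modelχq p i 2 even_two).EtaleThetaData} {l : ℕ} (C : E.DoubleUnderline l) {N : ℕ+}
    (μ : (ThetaSetting.modelχq p i 2 even_two).CyclotomeMod l N) (hC : (ThetaSetting.modelχq p i 2 even_two).Compat)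
    (hS : (ThetaSetting.modelχq p i 2 even_two).Sec2Hyps) (h15 : ThetaSetting.Prop15iii E hC)
    (hext : ∀ γ : ↥C.Huu ≃ₜ* ↥C.Huu, ∃ Γ : PiTpχq p i 2 ≃ₜ* PiTpχq p i 2,
      (∀ h : C.Huu, Γ (h : PiTpχq p i 2) = ((γ h : C.Huu) : PiTpχq p i 2)) ∧
        (curveχq p i 2).DeltaTemp.map Γ.toMulEquiv.toMonoidHom = (curveχq p i 2).DeltaTemp)
    (hgal : ∀ γ : ↥C.Huu ≃ₜ* ↥C.Huu, ∃ t : GQp p, ∀ h : C.Huu,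
      (((γ h : C.Huu) : PiTpχq p i 2)).right = t * (h : PiTpχq p i 2).right * t⁻¹) :
    Literature.AnabelianGeometry.EtaleTheta.RigidData.Cor219_i_subquotients
      (C.rigidData μ hC hS h15 ⟨fun _ => ∅, fun _ => ∅, fun _ => rfl⟩) :=
  cor219_i_subquotients_modelχq p i 2 even_two C μ hC hS h15 _
    (rigidData_cor218_i_modelχq_of_extends_of_hgal p i C μ hC hS h15 hext hgal)

/-! ## §2. The Tate datum of record `(i, j) = (1, 2)`, `E := etaleThetaDataχqInr p` (empty labelling) -/

variable {l : ℕ} (C : (etaleThetaDataχqInr p).DoubleUnderline l) {N : ℕ+}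
  (μ : (ThetaSetting.modelχq p 1 2 even_two).CyclotomeMod l N)

/-- **F-0627 Cor. 2.19 (i), subquotients, for the rigidity data of the datum OF RECORD with the EMPTY cusp labelling,
from `hextΔ` ALONE when `p ≡ 1 (mod 4)`** (`h15 :=` abc-iut-w5-d171's `prop15iii_etaleThetaDataχqInr`).
[cite: MochizukiEtTh2009, Cor 2.19 (i) p.64] -/
theorem cor219_i_subquotients_modelTate_inr_of_extends_of_mod_four_eq_one (hp : p % 4 = 1)
    (hext : ∀ γ : ↥C.Huu ≃ₜ* ↥C.Huu, ∃ Γ : PiTpχq p 1 2 ≃ₜ* PiTpχq p 1 2,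
      (∀ h : C.Huu, Γ (h : PiTpχq p 1 2) = ((γ h : C.Huu) : PiTpχq p 1 2)) ∧
        (curveχq p 1 2).DeltaTemp.map Γ.toMulEquiv.toMonoidHom = (curveχq p 1 2).DeltaTemp) :
    Literature.AnabelianGeometry.EtaleTheta.RigidData.Cor219_i_subquotients
      (C.rigidData μ (compat_modelχq p 1 2 even_two) (ThetaSetting.modelχq_sec2Hyps p 1 2 even_two)
        (prop15iii_etaleThetaDataχqInr p _) ⟨fun _ => ∅, fun _ => ∅, fun _ => rfl⟩) :=
  cor219_i_subquotients_modelχq_of_extends_of_mod_four_eq_one p 1 hp C μ _ _ _ hext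

/-- **F-0627 Cor. 2.19 (i), subquotients, for the rigidity data of the datum OF RECORD with the EMPTY cusp labelling,
from {`hextΔ`, `hgal`}** (every `p`). [cite: MochizukiEtTh2009, Cor 2.19 (i) p.64] -/
theorem cor219_i_subquotients_modelTate_inr_of_extends_of_hgal
    (hext : ∀ γ : ↥C.Huu ≃ₜ* ↥C.Huu, ∃ Γ : PiTpχq p 1 2 ≃ₜ* PiTpχq p 1 2,
      (∀ h : C.Huu, Γ (h : PiTpχq p 1 2) = ((γ h : C.Huu) : PiTpχq p 1 2)) ∧
        (curveχq p 1 2).DeltaTemp.map Γ.toMulEquiv.toMonoidHom = (curveχq p 1 2).DeltaTemp)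
    (hgal : ∀ γ : ↥C.Huu ≃ₜ* ↥C.Huu, ∃ t : GQp p, ∀ h : C.Huu,
      (((γ h : C.Huu) : PiTpχq p 1 2)).right = t * (h : PiTpχq p 1 2).right * t⁻¹) :
    Literature.AnabelianGeometry.EtaleTheta.RigidData.Cor219_i_subquotients
      (C.rigidData μ (compat_modelχq p 1 2 even_two) (ThetaSetting.modelχq_sec2Hyps p 1 2 even_two)
        (prop15iii_etaleThetaDataχqInr p _) ⟨fun _ => ∅, fun _ => ∅, fun _ => rfl⟩) :=
  cor219_i_subquotients_modelχq_of_extends_of_hgal p 1 C μ _ _ _ hext hgal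

/-- **Cor. 2.19 (i) IN FULL (subquotients F-0627 ∧ both splittings F-0626) for the rigidity data of the datum OF RECORD
with the EMPTY cusp labelling, from `hextΔ` ALONE when `p ≡ 1 (mod 4)`** — §2 ∧ abc-iut-w6-d050's
`cor219_i_splittings_modelTate_inr_of_extends_of_mod_four_eq_one`. [cite: MochizukiEtTh2009, Cor 2.19 (i) p.64] -/
theorem cor219_i_modelTate_inr_of_extends_of_mod_four_eq_one (hp : p % 4 = 1)
    (hext : ∀ γ : ↥C.Huu ≃ₜ* ↥C.Huu, ∃ Γ : PiTpχq p 1 2 ≃ₜ* PiTpχq p 1 2,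
      (∀ h : C.Huu, Γ (h : PiTpχq p 1 2) = ((γ h : C.Huu) : PiTpχq p 1 2)) ∧
        (curveχq p 1 2).DeltaTemp.map Γ.toMulEquiv.toMonoidHom = (curveχq p 1 2).DeltaTemp) :
    Literature.AnabelianGeometry.EtaleTheta.RigidData.Cor219_i_subquotients
        (C.rigidData μ (compat_modelχq p 1 2 even_two) (ThetaSetting.modelχq_sec2Hyps p 1 2 even_two)
          (prop15iii_etaleThetaDataχqInr p _) ⟨fun _ => ∅, fun _ => ∅, fun _ => rfl⟩) ∧
      Literature.AnabelianGeometry.EtaleTheta.RigidData.Cor219_i_splittings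
        (C.rigidData μ (compat_modelχq p 1 2 even_two) (ThetaSetting.modelχq_sec2Hyps p 1 2 even_two)
          (prop15iii_etaleThetaDataχqInr p _) ⟨fun _ => ∅, fun _ => ∅, fun _ => rfl⟩) :=
  ⟨cor219_i_subquotients_modelTate_inr_of_extends_of_mod_four_eq_one p C μ hp hext,
    cor219_i_splittings_modelTate_inr_of_extends_of_mod_four_eq_one p C μ hp hext⟩

/-! ## §3 (v2, append-only). CENSUS CORRECTION: Cor. 2.19 (i) needs NEITHER `p ≡ 1 (mod 4)` NOR (HGAL) NOR the empty
labelling — `hextΔ` ALONE suffices, for EVERY `p`, EVERY `i` and EVERY cusp labelling `L`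

abc-iut-f-148 gen 2's `rigidData_cor219_i_modelχq_of_extends` (`Discharge/Sec2Cor219iAtModelChi.lean`, p439859,
2026-08-26) already proves BOTH halves of Cor. 2.19 (i) (subquotients F-0627 ∧ splittings F-0626) for
`C.rigidData μ hC hS h15 L` at `modelχq p i j hj` — every `p`, `i`, even `j`, every étale-theta datum, every `X̲̲`-choice,
every level and EVERY cusp labelling `L` — from `hextΔ` ALONE: Cor. 2.19 (i) consumes only the three `L`-free CORE
clauses of Cor. 2.18 (i) (`Ker(aug)`, `Ker(↠Θ)`, `θ⁻¹(l·Δ_Θ)` stable; `rigidData_core_of_extends`,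
`Sec2Cor218iCoreClauses` p439343) plus temp-slimness, never the `Π^tp_Ÿ`-clause or the cusp clause.  Hence §§1–2 above,
abc-iut-w6-d050's `cor219_i_splittings_modelχq_of_extends_of_mod_four_eq_one` & co. (p478893) and abc-iut-L1-t6's
`…_of_extends_of_hgal` forms (p479283) are all SPECIAL CASES of that theorem: their side conditions (`χ₄ ≡ 1`,
`p ≡ 1 (mod 4)`, `i` even, (HGAL), `L = L∅`) are NOT needed for Cor. 2.19 (i) — they matter only where the FULL Cor. 2.18 (i)
(with its `Π^tp_Ÿ`-clause) is consumed (Cor. 2.18 (iv), Cor. 2.19 (ii), (iii)).  The two theorems below restate nothing: they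
are gen 2's theorem READ in abc-iut-L6-d6's binder shape (`Γ : PiTpχq p i 2 ≃ₜ* PiTpχq p i 2`,
`(curveχq p i 2).DeltaTemp` — definitionally the setting's `PiTemp` / `DeltaTemp`), at `modelχq p i 2` and at the datum of
record, so that the K4 book can cite ONE name with the binder text of record. -/

/-- **Cor. 2.19 (i) IN FULL (subquotients F-0627 ∧ both splittings F-0626) at `modelχq p i 2`, for EVERY `p`, EVERY `i`,
every étale-theta datum `E`, every `X̲̲`-choice, every level `μ` and EVERY cusp labelling `L`, FROM `hextΔ` ALONE** —
abc-iut-f-148 gen 2's `rigidData_cor219_i_modelχq_of_extends` (p439859) in abc-iut-L6-d6's binder shape; no parity /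
(HGAL) / empty-labelling side condition. [cite: MochizukiEtTh2009, Cor 2.19 (i) p.64] -/
theorem cor219_i_modelχq_two_of_extends
    {E : (ThetaSetting.modelχq p i 2 even_two).EtaleThetaData} {l : ℕ} (C : E.DoubleUnderline l) {N : ℕ+}
    (μ : (ThetaSetting.modelχq p i 2 even_two).CyclotomeMod l N) (hC : (ThetaSetting.modelχq p i 2 even_two).Compat)
    (hS : (ThetaSetting.modelχq p i 2 even_two).Sec2Hyps) (h15 : ThetaSetting.Prop15iii E hC) (L : C.CuspLabels)
    (hext : ∀ γ : ↥C.Huu ≃ₜ* ↥C.Huu, ∃ Γ : PiTpχq p i 2 ≃ₜ* PiTpχq p i 2,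
      (∀ h : C.Huu, Γ (h : PiTpχq p i 2) = ((γ h : C.Huu) : PiTpχq p i 2)) ∧
        (curveχq p i 2).DeltaTemp.map Γ.toMulEquiv.toMonoidHom = (curveχq p i 2).DeltaTemp) :
    Literature.AnabelianGeometry.EtaleTheta.RigidData.Cor219_i_subquotients (C.rigidData μ hC hS h15 L) ∧
      Literature.AnabelianGeometry.EtaleTheta.RigidData.Cor219_i_splittings (C.rigidData μ hC hS h15 L) :=
  rigidData_cor219_i_modelχq_of_extends p i 2 even_two C μ hC hS h15 L hext

/-- **Cor. 2.19 (i) IN FULL for the rigidity data of the datum OF RECORD (`etaleThetaDataχqInr p`, `modelχq p 1 2`),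
EVERY `p`, every `X̲̲`-choice `C`, every level `μ`, EVERY cusp labelling `L`, FROM `hextΔ` ALONE** — K4 row 22
(EtTh:Cor2.19(i)) reads «RE-CLOSED ⟸ hextΔ» with NO `p mod 4` / (HGAL) / labelling qualifier
(`h15 :=` abc-iut-w5-d171's `prop15iii_etaleThetaDataχqInr`). [cite: MochizukiEtTh2009, Cor 2.19 (i) p.64] -/
theorem cor219_i_modelTate_inr_of_extends (L : C.CuspLabels)
    (hext : ∀ γ : ↥C.Huu ≃ₜ* ↥C.Huu, ∃ Γ : PiTpχq p 1 2 ≃ₜ* PiTpχq p 1 2,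
      (∀ h : C.Huu, Γ (h : PiTpχq p 1 2) = ((γ h : C.Huu) : PiTpχq p 1 2)) ∧
        (curveχq p 1 2).DeltaTemp.map Γ.toMulEquiv.toMonoidHom = (curveχq p 1 2).DeltaTemp) :
    Literature.AnabelianGeometry.EtaleTheta.RigidData.Cor219_i_subquotients
        (C.rigidData μ (compat_modelχq p 1 2 even_two) (ThetaSetting.modelχq_sec2Hyps p 1 2 even_two)
          (prop15iii_etaleThetaDataχqInr p _) L) ∧
      Literature.AnabelianGeometry.EtaleTheta.RigidData.Cor219_i_splittings
        (C.rigidData μ (compat_modelχq p 1 2 even_two) (ThetaSetting.modelχq_sec2Hyps p 1 2 even_two)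
          (prop15iii_etaleThetaDataχqInr p _) L) :=
  rigidData_cor219_i_modelχq_of_extends p 1 2 even_two C μ _ _ _ L hext

end Literature.AnabelianGeometry.EtaleTheta.SettingModel

end
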